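import Summits.QuantumAdvantage.QuantumAdvantage.Theorems.CubicForrelationNearExactIsExactSixSyndrome

/-!
# Crux `CubicForrelation.NearExactIsExact` (stmt-QuantumAdvantage-14043) — the exact partner test of the census at
  `n = 6` (`θ₆ = 25/32`), part 2/4: the checker and its soundness

Certificate seat `b2b-cforr-cert` (gen 10).  HONEST FRAMING: a verified CHECKER for a decidable verdict about the finite
slice `n = 6` — NOT summit progress.

For a cubic `g` on `n = m + m` bits with integer Walsh table `W_g` (computed by the tree's verified fast transform
`wal`), the per-function test `ck_checkS m T` accepts when (i) `g` is bent on codes (then `Φ(f,g) ∈ {1} ∪ [−1, 3/4]`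
for cubic `f`, Hou + Reed–Muller distance, as in `SmallCases`), or (ii) the capacity `Σ|W_g| ≤ T`, or (iii) the
MEET-IN-THE-MIDDLE SYNDROME TEST `ck_mitm`: with `cap = Σ|W_g| > T`, `B = ⌊(cap − T − 1)/2⌋` and `wmin = min|W_g| > 0`,
`B < 5·wmin`, no set `M` of codes of total weight `Σ_{x∈M}|W_g(x)| ≤ B` (necessarily `|M| ≤ 4`, split as `≤ 2` LIGHT
points searched `+ ≤ 2` points looked up in a complete table of column-XORs) has column-XOR equal to the syndrome of
the sign pattern `σ = [W_g < 0]`.  SOUNDNESS (`ck_mitm_sound`, `ck_checkS_sound`): a cubic partner `f` with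
`Σ_x (−1)^{f(x)} W_g(x) > T` disagrees with `σ` exactly on a set `M` of weight `≤ B`, and `σ ⊕ f = 1_M` has the
syndrome of `σ` because cubic functions have syndrome `0` (part 1, `sy_synd_cubic`).  Hence every cubic `f` has
`Φ(f,g)·2^{3m} ≤ T` in case (iii).

References: F. J. MacWilliams, N. J. A. Sloane, *The Theory of Error-Correcting Codes* (1977) Ch. 13; C. Carlet,
*Boolean Functions for Cryptography and Coding Theory* (CUP 2021) §2.2.1, §6.1; S. Aaronson, A. Ambainis,
*Forrelation*, SIAM J. Comput. 47 (2018) §1.1.1.  Everything below is proved from the tree; axioms are the standard three.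
-/

set_option linter.dupNamespace false -- D-0017: single-problem summit ⇒ `QuantumAdvantage.QuantumAdvantage` by design

namespace Summit.QuantumAdvantage.QuantumAdvantage.Theorems.CubicForrelation.NearExactIsExact

open Finset
open Literature.Computability.QuantumComplexity
open Literature.Computability.QuantumComplexity.DerivativeWalsh (W fsum phi_eq_fsum fsum_eq_sum_mul_W)
open Literature.Computability.QuantumComplexity.BuzetChailloux (phi_signOf)
open Summit.QuantumAdvantage.QuantumAdvantage.Theorems.NearExactIsExact.Negative.SmallCases
  (pt sgnZ wal length_wal wspec W_pt sigTable wal_sigTable signOf_eq_cast sum_pt forrelation_le_cap bent_of_abs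
    sum_map_eq_sum_range)

/-! ### Tables: columns and the complete pair table -/

/-- Array read with default `0`. -/
def ck_aget (a : Array ℕ) (k : ℕ) : ℕ := a[k]?.getD 0

/-- The column table of `n` (`sy_col n k` for the codes `k < 2^n`). -/
def ck_cols (n : ℕ) : Array ℕ := ((List.range (2 ^ n)).map (sy_col n)).toArray

/-- Run-time check that a column table is correct on the codes `< 2^n` (replaces an indexing proof). -/
def ck_colsOK (n : ℕ) (cols : Array ℕ) : Bool := (List.range (2 ^ n)).all fun k => ck_aget cols k == sy_col n k

/-- A checked column table agrees with `sy_col`. [folklore] -/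
theorem ck_colsOK_spec {n : ℕ} {cols : Array ℕ} (h : ck_colsOK n cols = true) :
    ∀ k, k < 2 ^ n → ck_aget cols k = sy_col n k := by
  intro k hk
  simp only [ck_colsOK, List.all_eq_true, List.mem_range, beq_iff_eq] at h
  exact h k hk

/-- The point lists of length `≤ 2` over the codes `< N`: `[]`, `[a]`, `[a, b]` with `a < b`. -/
def ck_smallLists (N : ℕ) : List (List ℕ) :=
  [] :: (((List.range N).map fun a => [a]) ++
    ((List.range N).flatMap fun a => ((List.range N).filter fun b => a < b).map fun b => [a, b]))

/-- Membership in `ck_smallLists`. [folklore] -/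
theorem ck_mem_smallLists {N : ℕ} {L : List ℕ} (hlen : L.length ≤ 2) (hlt : ∀ k ∈ L, k < N)
    (hpw : L.Pairwise (· < ·)) : L ∈ ck_smallLists N := by
  unfold ck_smallLists
  match L, hlen with
  | [], _ => exact List.mem_cons_self
  | [a], _ =>
    refine List.mem_cons_of_mem _ (List.mem_append_left _ ?_)
    exact List.mem_map.2 ⟨a, List.mem_range.2 (hlt a (by simp)), rfl⟩
  | [a, b], _ =>
    refine List.mem_cons_of_mem _ (List.mem_append_right _ ?_)
    rw [List.mem_flatMap]
    refine ⟨a, List.mem_range.2 (hlt a (by simp)), List.mem_map.2 ⟨b, ?_, rfl⟩⟩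
    rw [List.mem_filter]
    refine ⟨List.mem_range.2 (hlt b (by simp)), ?_⟩
    have : a < b := by
      have h := hpw; simp at h; exact h
    simpa using this
  | _ :: _ :: _ :: _, h => simp at h

/-- The PAIR TABLE: at index `t`, recorded point lists with column-XOR `t` (built once; only its completeness is used). -/
def ck_mkPtab (nbits : ℕ) (cols : Array ℕ) (N : ℕ) : Array (List (List ℕ)) :=
  (ck_smallLists N).foldl (fun arr L => arr.modify (sy_xorCols (ck_aget cols) L) fun ls => L :: ls)
    (Array.replicate (2 ^ nbits) [])

/-- Pair-table read with default `[]`. -/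
def ck_pget (ptab : Array (List (List ℕ))) (t : ℕ) : List (List ℕ) := ptab[t]?.getD []

/-- Run-time completeness check of a pair table: every point list of length `≤ 2` is recorded at its column-XOR. -/
def ck_ptabOK (cols : Array ℕ) (N : ℕ) (ptab : Array (List (List ℕ))) : Bool :=
  (ck_smallLists N).all fun L => (ck_pget ptab (sy_xorCols (ck_aget cols) L)).contains L

/-- A checked pair table is complete. [folklore] -/
theorem ck_ptabOK_spec {cols : Array ℕ} {N : ℕ} {ptab : Array (List (List ℕ))} (h : ck_ptabOK cols N ptab = true) :
    ∀ L ∈ ck_smallLists N, L ∈ ck_pget ptab (sy_xorCols (ck_aget cols) L) := by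
  intro L hL
  simp only [ck_ptabOK, List.all_eq_true] at h
  exact List.contains_iff_mem.1 (h L hL)

/-! ### Weights, halves and the meet-in-the-middle test -/

/-- Total weight `Σ_{k ∈ L} |W(k)|` of a point list. -/
def ck_wsum (absA : Array ℕ) : List ℕ → ℕ
  | [] => 0
  | k :: ks => ck_aget absA k + ck_wsum absA ks

/-- Weight is additive over concatenation. [folklore] -/
theorem ck_wsum_append (absA : Array ℕ) : ∀ L L' : List ℕ, ck_wsum absA (L ++ L') = ck_wsum absA L + ck_wsum absA L'
  | [], L' => by simp [ck_wsum]
  | k :: ks, L' => by rw [List.cons_append, ck_wsum, ck_wsum, ck_wsum_append absA ks L']; ring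

/-- An element weighs at most the total. [folklore] -/
theorem ck_le_wsum (absA : Array ℕ) : ∀ (L : List ℕ) (k : ℕ), k ∈ L → ck_aget absA k ≤ ck_wsum absA L
  | [], k, h => by simp at h
  | j :: js, k, h => by
    rw [ck_wsum]
    rcases List.mem_cons.1 h with rfl | h
    · omega
    · have := ck_le_wsum absA js k h; omega

/-- A uniform lower bound on the element weights bounds the total from below. [folklore] -/
theorem ck_mul_length_le_wsum (absA : Array ℕ) (w : ℕ) : ∀ L : List ℕ, (∀ k ∈ L, w ≤ ck_aget absA k) →
    w * L.length ≤ ck_wsum absA L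
  | [], _ => by simp
  | j :: js, h => by
    rw [ck_wsum, List.length_cons]
    have h1 := h j List.mem_cons_self
    have h2 := ck_mul_length_le_wsum absA w js fun k hk => h k (List.mem_cons_of_mem _ hk)
    nlinarith

/-- Weight of a filtered list as a sum of indicators. [folklore] -/
theorem ck_wsum_filter (absA : Array ℕ) (p : ℕ → Bool) : ∀ L : List ℕ,
    ck_wsum absA (L.filter p) = (L.map fun k => if p k then ck_aget absA k else 0).sum
  | [] => by simp [ck_wsum]
  | k :: ks => by
    rw [List.filter_cons, List.map_cons, List.sum_cons, ← ck_wsum_filter absA p ks]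
    cases p k <;> simp [ck_wsum]

/-- A `foldr min` is at most every listed value. [folklore] -/
theorem ck_foldr_min_le (F : ℕ → ℕ) (a : ℕ) : ∀ (L : List ℕ) (k : ℕ), k ∈ L → (L.map F).foldr min a ≤ F k
  | [], k, h => by simp at h
  | j :: js, k, h => by
    rw [List.map_cons, List.foldr_cons]
    rcases List.mem_cons.1 h with rfl | h
    · exact min_le_left _ _
    · exact (min_le_right _ _).trans (ck_foldr_min_le F a js k h)

/-- List sum over `range N` as a `Finset` sum. [folklore] -/
theorem ck_sum_map_range {M : Type*} [AddCommMonoid M] (F : ℕ → M) : ∀ N : ℕ,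
    ((List.range N).map F).sum = ∑ k ∈ range N, F k
  | 0 => by simp
  | N + 1 => by rw [List.range_succ, List.map_append, List.sum_append, ck_sum_map_range F N, sum_range_succ]; simp

/-- The LIGHT HALVES searched: `[]`, the singletons of `pts`, and (if `withPairs`) the pairs `[a, b]`, `a < b` in `pts`,
of weight `≤ B`. -/
def ck_halves (absA : Array ℕ) (B : ℕ) (withPairs : Bool) (pts : List ℕ) : List (List ℕ) :=
  [] :: ((pts.map fun a => [a]) ++
    (if withPairs then
      pts.flatMap fun a => (pts.filter fun b => a < b && decide (ck_aget absA a + ck_aget absA b ≤ B)).map fun b => [a, b]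
     else []))

/-- The MEET-IN-THE-MIDDLE test: no light half `h` and recorded list `L` at `S ⊕ xorCols h` have joint weight `≤ B`. -/
def ck_pairFree (cols absA : Array ℕ) (ptab : Array (List (List ℕ))) (S B : ℕ) (halves : List (List ℕ)) : Bool :=
  halves.all fun h => (ck_pget ptab (S ^^^ sy_xorCols (ck_aget cols) h)).all fun L =>
    decide (B < ck_wsum absA L + ck_wsum absA h)

/-- Absolute-value table of an integer list. -/
def ck_absArr (ws : List ℤ) : Array ℕ := (ws.map Int.natAbs).toArray

/-- The sign pattern `σ(k) = [W(k) < 0]`. -/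
def ck_neg (wa : Array ℤ) (k : ℕ) : Bool := decide (wa[k]?.getD 0 < 0)

/-- The syndrome branch of the per-function test (see the file header). -/
def ck_mitm (n THR : ℕ) (cols : Array ℕ) (ptab : Array (List (List ℕ))) (ws : List ℤ) : Bool :=
  let N := 2 ^ n
  let wa := ws.toArray
  let absA := ck_absArr ws
  let cap := ((List.range N).map (ck_aget absA)).sum
  let B := (cap - THR - 1) / 2
  let wmin := ((List.range N).map (ck_aget absA)).foldr min (cap + 1)
  decide (THR < cap) && decide (0 < wmin) && decide (B < 5 * wmin) &&
    ck_pairFree cols absA ptab (sy_synd (ck_aget cols) (ck_neg wa) (List.range N)) B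
      (ck_halves absA B (decide (3 * wmin ≤ B)) ((List.range N).filter fun k => ck_aget absA k ≤ B))

/-- **The per-function test** for `n = m + m`: bent on codes, or capacity `≤ THR`, or (`m ≥ 3`) the syndrome branch. -/
def ck_checkS (m THR : ℕ) (cols : Array ℕ) (ptab : Array (List (List ℕ))) (v : List ℤ) : Bool :=
  let ws := wal (m + m) v
  let as := ws.map Int.natAbs
  as.all (· == 2 ^ m) || decide (as.sum ≤ THR) || (decide (3 ≤ m) && ck_mitm (m + m) THR cols ptab ws)

/-! ### Soundness of the syndrome branch -/

/-- Reading the absolute-value table. [folklore] -/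
theorem ck_aget_absArr (ws : List ℤ) (k : ℕ) (hk : k < ws.length) :
    (ck_aget (ck_absArr ws) k : ℤ) = |ws[k]?.getD 0| := by
  unfold ck_aget ck_absArr
  rw [List.getElem?_toArray, List.getElem?_map, List.getElem?_eq_getElem hk]
  simp only [Option.map_some, Option.getD_some]
  exact Int.natCast_natAbs _

/-- Reading the sign pattern. [folklore] -/
theorem ck_neg_toArray (ws : List ℤ) (k : ℕ) : ck_neg ws.toArray k = decide (ws[k]?.getD 0 < 0) := by
  unfold ck_neg; rw [List.getElem?_toArray]

/-- The pointwise value identity: `(−1)^b · w = |w| − 2·[b ≠ [w<0]]·|w|`. [folklore] -/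
theorem ck_sgnZ_mul (b : Bool) (w : ℤ) :
    sgnZ b * w = |w| - 2 * (if xor b (decide (w < 0)) then |w| else 0) := by
  by_cases hw : w < 0
  · rw [abs_of_neg hw, decide_eq_true hw]; cases b <;> simp [sgnZ]
    ring
  · rw [abs_of_nonneg (not_lt.1 hw), decide_eq_false hw]; cases b <;> simp [sgnZ]
    ring

/-- Membership in the light halves. [folklore] -/
theorem ck_mem_halves {absA : Array ℕ} {B : ℕ} {withPairs : Bool} {pts L : List ℕ} (hlen : L.length ≤ 2)
    (hsub : ∀ k ∈ L, k ∈ pts) (hpw : L.Pairwise (· < ·)) (hw : ck_wsum absA L ≤ B)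
    (hpairs : L.length = 2 → withPairs = true) : L ∈ ck_halves absA B withPairs pts := by
  unfold ck_halves
  match L, hlen, hpairs, hw, hpw with
  | [], _, _, _, _ => exact List.mem_cons_self
  | [a], _, _, _, _ =>
    exact List.mem_cons_of_mem _ (List.mem_append_left _ (List.mem_map.2 ⟨a, hsub a (by simp), rfl⟩))
  | [a, b], _, hp, hw, hpw =>
    refine List.mem_cons_of_mem _ (List.mem_append_right _ ?_)
    rw [hp rfl, if_pos rfl, List.mem_flatMap]
    refine ⟨a, hsub a (by simp), List.mem_map.2 ⟨b, ?_, rfl⟩⟩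
    rw [List.mem_filter]
    refine ⟨hsub b (by simp), ?_⟩
    have hab : a < b := by have h := hpw; simp at h; exact h
    have hw' : ck_aget absA a + ck_aget absA b ≤ B := by simpa [ck_wsum] using hw
    simp [hab, hw']
  | _ :: _ :: _ :: _, h, _, _, _ => simp at h

/-- **Soundness of the syndrome branch.** If `ck_mitm` accepts the Walsh table of `g` (`n ≥ 6`, correct columns,
complete pair table), then every cubic `f` has `Σ_k (−1)^{f(pt k)} W_g(pt k) ≤ THR`. [this work] -/
theorem ck_mitm_sound {n THR : ℕ} (hn : 6 ≤ n) {cols : Array ℕ} (hcols : ∀ k, k < 2 ^ n → ck_aget cols k = sy_col n k)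
    {ptab : Array (List (List ℕ))} (hptab : ∀ L ∈ ck_smallLists (2 ^ n), L ∈ ck_pget ptab (sy_xorCols (ck_aget cols) L))
    (g : (Fin n → Bool) → Bool) (h : ck_mitm n THR cols ptab (wal n (sigTable n g)) = true)
    (f : (Fin n → Bool) → Bool) (hf : IsDegLeFun 3 f) :
    ∑ k ∈ range (2 ^ n), sgnZ (f (pt n k)) * wspec n g k ≤ THR := by
  set N := 2 ^ n with hN
  set ws := wal n (sigTable n g) with hws
  have hlen : ws.length = N := length_wal _ _ (by simp [sigTable])
  set absA := ck_absArr ws with habsA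
  set cap := ((List.range N).map (ck_aget absA)).sum with hcap
  set B := (cap - THR - 1) / 2 with hB
  set wmin := ((List.range N).map (ck_aget absA)).foldr min (cap + 1) with hwmin
  set σ := ck_neg ws.toArray with hσ
  set S := sy_synd (ck_aget cols) σ (List.range N) with hS
  set pts := (List.range N).filter fun k => ck_aget absA k ≤ B with hpts
  have h' : ((THR < cap ∧ 0 < wmin) ∧ B < 5 * wmin) ∧
      ck_pairFree cols absA ptab S B (ck_halves absA B (decide (3 * wmin ≤ B)) pts) = true := by
    simpa [ck_mitm, ← hN, ← hws, ← habsA, ← hcap, ← hB, ← hwmin, ← hσ, ← hS, ← hpts] using h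
  obtain ⟨⟨⟨hTHR, hwpos⟩, hB5⟩, hpf⟩ := h'
  -- the partner's values on codes and the mismatch predicate
  set s : ℕ → Bool := fun k => f (pt n k) with hs
  set p : ℕ → Bool := fun k => xor (s k) (σ k) with hp
  -- weights read as integers
  have habs : ∀ k, k < N → (ck_aget absA k : ℤ) = |wspec n g k| := by
    intro k hk
    rw [habsA, ck_aget_absArr ws k (by rw [hlen]; exact hk), hws, wal_sigTable n g k hk]
  have hσk : ∀ k, k < N → σ k = decide (wspec n g k < 0) := by
    intro k hk
    rw [hσ, ck_neg_toArray, hws, wal_sigTable n g k hk]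
  -- value identity: Σ (−1)^f W = cap − 2·W_M
  set M := (List.range N).filter p with hM
  have hcapZ : (cap : ℤ) = ∑ k ∈ range N, |wspec n g k| := by
    rw [hcap, ck_sum_map_range]; push_cast
    exact sum_congr rfl fun k hk => habs k (mem_range.1 hk)
  have hWM : (ck_wsum absA M : ℤ) = ∑ k ∈ range N, (if p k then |wspec n g k| else 0) := by
    rw [hM, ck_wsum_filter, ck_sum_map_range]; push_cast
    refine sum_congr rfl fun k hk => ?_
    split_ifs <;> simp [habs k (mem_range.1 hk)]
  have hval : ∑ k ∈ range N, sgnZ (s k) * wspec n g k = (cap : ℤ) - 2 * (ck_wsum absA M : ℤ) := by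
    rw [hcapZ, hWM, mul_sum, ← sum_sub_distrib]
    refine sum_congr rfl fun k hk => ?_
    rw [ck_sgnZ_mul, hp]
    simp only [hσk k (mem_range.1 hk)]
  -- suppose the value exceeds THR
  by_contra hgt
  rw [not_le, hval] at hgt
  have hWB : ck_wsum absA M ≤ B := by
    rw [hB, Nat.le_div_iff_mul_le (by norm_num)]
    have : 2 * (ck_wsum absA M : ℤ) < (cap : ℤ) - THR := by linarith
    omega
  -- every mismatch point is a candidate point, and there are at most four of them
  have hMmem : ∀ k ∈ M, k < N ∧ p k = true := fun k hk => by
    have := List.mem_filter.1 (hM ▸ hk); exact ⟨List.mem_range.1 this.1, this.2⟩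
  have hwmin_le : ∀ k ∈ M, wmin ≤ ck_aget absA k := fun k hk =>
    ck_foldr_min_le (ck_aget absA) (cap + 1) (List.range N) k (List.mem_range.2 (hMmem k hk).1)
  have hMlen : M.length ≤ 4 := by
    have h1 := ck_mul_length_le_wsum absA wmin M hwmin_le
    have h2 : wmin * M.length < 5 * wmin := by omega
    nlinarith
  have hMpts : ∀ k ∈ M, k ∈ pts := fun k hk => by
    rw [hpts, List.mem_filter]
    exact ⟨List.mem_range.2 (hMmem k hk).1, decide_eq_true ((ck_le_wsum absA M k hk).trans hWB)⟩
  have hMpw : M.Pairwise (· < ·) := by rw [hM]; exact List.pairwise_lt_range.filter _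
  -- the syndrome of the mismatch set is `S`
  have hsyn0 : sy_synd (ck_aget cols) s (List.range N) = 0 := sy_synd_cubic hn _ hcols f hf
  have hsynM : sy_xorCols (ck_aget cols) M = S := by
    rw [hM, ← sy_synd_eq_xorCols, hp, sy_synd_bxor, hsyn0, hS, Nat.zero_xor]
  -- split `M` into a light half `h₁` (searched) and a heavy half `h₂` (looked up)
  set j := M.length - 2 with hj
  set h₁ := M.take j with hh₁
  set h₂ := M.drop j with hh₂
  have hsplit : h₁ ++ h₂ = M := List.take_append_drop j M
  have hlen₁ : h₁.length ≤ 2 := by rw [hh₁, List.length_take]; omega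
  have hlen₂ : h₂.length ≤ 2 := by rw [hh₂, List.length_drop]; omega
  have hsub₁ : ∀ k ∈ h₁, k ∈ M := fun k hk => List.mem_of_mem_take hk
  have hsub₂ : ∀ k ∈ h₂, k ∈ M := fun k hk => List.mem_of_mem_drop hk
  have hpw₁ : h₁.Pairwise (· < ·) := hMpw.sublist (List.take_sublist j M)
  have hpw₂ : h₂.Pairwise (· < ·) := hMpw.sublist (List.drop_sublist j M)
  have hwsplit : ck_wsum absA h₁ + ck_wsum absA h₂ = ck_wsum absA M := by rw [← ck_wsum_append, hsplit]
  have hx : S ^^^ sy_xorCols (ck_aget cols) h₁ = sy_xorCols (ck_aget cols) h₂ := by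
    rw [← hsynM, ← hsplit, sy_xorCols_append, Nat.xor_comm, ← Nat.xor_assoc, Nat.xor_self, Nat.zero_xor]
  -- `h₁` is among the searched halves, `h₂` is recorded in the pair table
  have hmem₁ : h₁ ∈ ck_halves absA B (decide (3 * wmin ≤ B)) pts := by
    refine ck_mem_halves hlen₁ (fun k hk => hMpts k (hsub₁ k hk)) hpw₁
      ((Nat.le_add_right _ _).trans (hwsplit.le.trans hWB)) fun h2 => ?_
    have hM4 : M.length = 4 := by rw [hh₁, List.length_take] at h2; omega
    have h1 := ck_mul_length_le_wsum absA wmin M hwmin_le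
    rw [hM4] at h1
    exact decide_eq_true (by omega)
  have hmem₂ : h₂ ∈ ck_pget ptab (sy_xorCols (ck_aget cols) h₂) :=
    hptab h₂ (ck_mem_smallLists hlen₂ (fun k hk => (hMmem k (hsub₂ k hk)).1) hpw₂)
  -- the test says their joint weight exceeds `B`: contradiction
  simp only [ck_pairFree, List.all_eq_true, decide_eq_true_eq] at hpf
  have hfin := hpf h₁ hmem₁ h₂ (by rw [hx]; exact hmem₂)
  omega

/-! ### Soundness of the per-function test -/

/-- **The forrelation value as an integer sum on codes**: `Φ(f,g)·2^{3m} = Σ_k (−1)^{f(pt k)} W_g(k)`. [folklore] -/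
theorem ck_forrelation_mul_eq (m : ℕ) (f g : (Fin (m + m) → Bool) → Bool) :
    forrelation f g * (2 : ℝ) ^ (3 * m) = ((∑ k ∈ range (2 ^ (m + m)), sgnZ (f (pt (m + m) k)) * wspec (m + m) g k : ℤ) : ℝ) := by
  have hs : Real.sqrt ((2 : ℝ) ^ (3 * (m + m))) = (2 : ℝ) ^ (3 * m) := by
    rw [show (2 : ℝ) ^ (3 * (m + m)) = ((2 : ℝ) ^ (3 * m)) ^ 2 by ring, Real.sqrt_sq (by positivity)]
  have hpos : (0 : ℝ) < (2 : ℝ) ^ (3 * m) := by positivity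
  rw [← phi_signOf, phi_eq_fsum, fsum_eq_sum_mul_W, hs, inv_mul_eq_div, div_mul_cancel₀ _ hpos.ne', sum_pt]
  push_cast
  refine sum_congr rfl fun y _ => ?_
  rw [W_pt, signOf_eq_cast]

/-- **Soundness of the per-function test** (`1 ≤ m ≤ 4`, correct columns, complete pair table): if `ck_checkS m THR`
accepts the signed table of a cubic `g`, then every cubic `f` has `Φ(f,g) = 1`, or `Φ(f,g) ≤ 3/4`, or
`Φ(f,g)·2^{3m} ≤ THR`. [this work] -/
theorem ck_checkS_sound (m THR : ℕ) (hm1 : 1 ≤ m) (hm4 : m ≤ 4) {cols : Array ℕ}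
    (hcols : ∀ k, k < 2 ^ (m + m) → ck_aget cols k = sy_col (m + m) k) {ptab : Array (List (List ℕ))}
    (hptab : ∀ L ∈ ck_smallLists (2 ^ (m + m)), L ∈ ck_pget ptab (sy_xorCols (ck_aget cols) L))
    (g : (Fin (m + m) → Bool) → Bool) (hg : IsDegLeFun 3 g)
    (hc : ck_checkS m THR cols ptab (sigTable (m + m) g) = true)
    (f : (Fin (m + m) → Bool) → Bool) (hf : IsDegLeFun 3 f) :
    forrelation f g = 1 ∨ forrelation f g ≤ 3 / 4 ∨ forrelation f g * (2 : ℝ) ^ (3 * m) ≤ THR := by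
  have hlen : (wal (m + m) (sigTable (m + m) g)).length = 2 ^ (m + m) := length_wal _ _ (by simp [sigTable])
  simp only [ck_checkS, Bool.or_eq_true, Bool.and_eq_true, List.all_eq_true, beq_iff_eq, decide_eq_true_eq] at hc
  rcases hc with (hb | hs) | ⟨hm3, hmitm⟩
  · -- bent on codes: Hou + Reed–Muller
    have hb' : ∀ y, y < 2 ^ (m + m) → |wspec (m + m) g y| = 2 ^ m := by
      intro y hy
      have hmem : Int.natAbs ((wal (m + m) (sigTable (m + m) g))[y]?.getD 0) ∈
          (wal (m + m) (sigTable (m + m) g)).map Int.natAbs := by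
        rw [List.getElem?_eq_getElem (by rw [hlen]; exact hy), Option.getD_some]
        exact List.mem_map.2 ⟨_, List.getElem_mem _, rfl⟩
      have e := hb _ hmem
      rw [wal_sigTable _ _ _ hy] at e
      rw [Int.abs_eq_natAbs, e]; push_cast; rfl
    obtain ⟨d, hd⟩ := bb_exists_dual (bent_of_abs m g hb')
    have hdeg : IsDegLeFun 3 d := (stub_houCubic stub_axParity m g d hg hd).mono (by omega)
    rcases bb_band_of_dual_degree bb_rmWeight_holds m 3 f g d hf hdeg hd with h1 | h1
    · exact Or.inl h1
    · right; left; norm_num at h1; linarith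
  · -- capacity
    right; right
    rw [sum_map_eq_sum_range _ 0, hlen] at hs
    have e : ∑ y ∈ range (2 ^ (m + m)), |wspec (m + m) g y| =
        ((∑ i ∈ range (2 ^ (m + m)), ((wal (m + m) (sigTable (m + m) g))[i]?.getD 0).natAbs : ℕ) : ℤ) := by
      push_cast
      refine sum_congr rfl fun y hy => ?_
      rw [← wal_sigTable _ _ _ (mem_range.1 hy), Int.abs_eq_natAbs]
    have hcap := forrelation_le_cap m f g
    have hs' : ((∑ y ∈ range (2 ^ (m + m)), |wspec (m + m) g y| : ℤ) : ℝ) ≤ THR := by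
      rw [e]; exact_mod_cast hs
    exact hcap.trans hs'
  · -- syndrome branch
    right; right
    rw [ck_forrelation_mul_eq]
    exact_mod_cast ck_mitm_sound (by omega) hcols hptab g hmitm f hf

end Summit.QuantumAdvantage.QuantumAdvantage.Theorems.CubicForrelation.NearExactIsExact
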